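import Summits.ABC.ABC.Theorems.IneffectiveSubspacePrimePowerRadicalStubCashout
import Summits.ABC.ABC.Theorems.IneffectiveSubspacePrimePowerRadicalStubVojtaShapeOfCrux
import Summits.ABC.ABC.Theorems.IneffectiveSubspacePrimePowerRadicalStubPPRAtOfSqDivisorBound
import Summits.ABC.ABC.Theorems.IneffectiveSubspacePrimePowerRadicalStubLevel2Calibration

/-!
# Line `nevbir-below-beta` for the crux `PrimePowerRadical` (stmt-ABC-1648) — FINAL skeleton (lead c2)

Crux (route ABC/IneffectiveSubspace, rank 3): `Summit.ABC.ABC.Theses.IneffectiveSubspace.PrimePowerRadical` =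
`∀ q prime, ∀ ε > 0, ∃ C > 0, ∀ k ≥ 1, q^k < C · rad(1·(q^k−1)·q^k)^{1+ε}`.

This is the planner's skeleton `Cruxes/PrimePowerRadical/Lines/nevbir_below_beta.lean` (2026-08-16T09:09Z) after
lead c1's L1 reshape (exceptional curve cut to `F = 1`, `stub_exceptionalCurves` folded into the bet) and after
EVERY provable stub has LANDED through the gate (all `--supports stmt-ABC-1648`, namespace
`Summit.ABC.ABC.Theorems.PrimePowerRadical.NevbirBelowBeta`):

* `stub_cashout` — `…StubCashout.lean` p111458 (c1's worker): adaptive design `u_n(k) = ∏_{v_p≥2} p^⌈v_p/n⌉`.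
* `stub_PPRAt_of_sqDivisorBound` — `…StubPPRAtOfSqDivisorBound.lean` p111417 (c1's worker).
* `stub_vojtaShape_of_crux` — `…StubVojtaShapeOfCrux.lean` p111494 (c1): the crux ⟹ every Vojta-shape instance.
* `stub_level2_iff_sqDivisorBound` — `…StubLevel2Calibration.lean` p111511 (c1): level-2 bet ⟺ `μ < 1/2`.
* `stub_towerBet_iff_PPRAt` — `…StubTowerBetCalibration.lean` p114863 (c2): tower bet at `q` ⟺ crux at `q`
  (not imported here only because this skeleton was checked on a farm snapshot preceding p114863; its `→` half is
  inlined verbatim in `PrimePowerRadical_of`).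

What remains are the two BETS, kept here verbatim as registered (sorried):

* `stub_tower_toVojta` (composition path) — by `stub_towerBet_iff_PPRAt` it is, at each prime `q`, LITERALLY
  EQUIVALENT to the crux at `q`; the composition `PrimePowerRadical_of` below is its `→` half.
* `stub_level2_beyondLiouville` (milestone path) — by `stub_level2_iff_sqDivisorBound` it is equivalent to a
  square-divisor exponent `μ < 1/2`, which gives (`stub_PPRAt_of_sqDivisorBound` + the landed level ladder
  `Negative.infinite_level_le_of_PPRAt`) a rung of the Wieferich level ladder at `q` (`ladderRung_of_level2`), open
  for every base and every rung (Disproof.lean §13).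

Both bets asked for a subspace-theorem constant (Ru–Vojta's birational Nevanlinna constant of
`(X'_n, H − Σ c_i e_{i+1}, b_H(L̃_X + L̃_Z) + b_Y L̃_Y)`) strictly below the Liouville constant `1/τ`; lead c1 showed,
and lead c2 re-derived independently (`Lines/nevbir-below-beta.dead.md`, `Lines/nevbir-below-beta-c2.dead.md`), that
`Nev_bir(L, D_w) = 1/τ(L, D_w)` on every such tower, for all polarisations, weights and levels (torus `y ↦ ty`
⟹ per-weight-slice two-target Roth on `P¹_{(x:z)}` ⟹ Liouville). So neither bet can come out of the line's
`Leans on`, and on the family each is the open statement it was meant to prove: the LINE is dead, the crux untouched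
(double wall `Negative.primePowerRadical_dichotomy`, p78703).
-/

noncomputable section

set_option linter.dupNamespace false

namespace Summit.ABC.ABC.Cruxes.PrimePowerRadical.NevbirBelowBeta

open Literature.NumberTheory.DiophantineGeometry UniqueFactorizationMonoid
open Summit.ABC.ABC.Theses.IneffectiveSubspace
open Summit.ABC.ABC.Theorems.PrimePowerRadical.Negative
open Summit.ABC.ABC.Theorems.PrimePowerRadical.NevbirBelowBeta
open scoped BigOperators

/-! ## The two bets (registered stubs, open; each kernel-calibrated against the crux) -/

/-- **stub_tower_toVojta (THE BET; ⟺ the crux at `q` by `stub_towerBet_iff_PPRAt`, p114863).** For every prime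
`q` and target exponent `θ > 0` some level `n ≥ 3` of the tower `X'_n` carries a TRUE weighted inequality at the
family points `(q^k, u)`, `u ∣ q^k − 1` (with `F = 1`), whose parameters are beyond Liouville with margin ratio
`≤ θ`: `0 ≤ θ₀ := 1 + ε − 2b_H − b_Y ≤ θ·κ_n`, `κ_n := (1+ε)c_min − b_Y(n+1)/(2n) > 0`. Its only proposed SOURCE
(Nev_bir of the explicit pairs along the tower) is refuted: Nev_bir = 1/τ there (Lines/nevbir-below-beta*.dead.md). -/
theorem stub_tower_toVojta (q : ℕ) (hq : q.Prime) (θ : ℝ) (hθ : 0 < θ) :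
    ∃ n : ℕ, 3 ≤ n ∧ ∃ (c : ℕ → ℝ) (cmin bH bY ε : ℝ),
      (∀ i : ℕ, i < n → cmin ≤ c i) ∧ 0 ≤ bH ∧ 0 ≤ bY ∧ 0 ≤ ε ∧
      0 < (1 + ε) * cmin - bY * (((n : ℝ) + 1) / (2 * n)) ∧
      0 ≤ 1 + ε - 2 * bH - bY ∧
      1 + ε - 2 * bH - bY ≤ θ * ((1 + ε) * cmin - bY * (((n : ℝ) + 1) / (2 * n))) ∧
      ∃ C : ℝ, ∀ k : ℕ, 1 ≤ k → ∀ u : ℕ, u ∣ q ^ k - 1 →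
        MvPolynomial.eval ![((q : ℤ) ^ k), (u : ℤ)] (1 : MvPolynomial (Fin 2) ℤ) ≠ 0 →
          bH * (2 * ((k : ℝ) * Real.log q)) + bY * ((k : ℝ) * Real.log q - Real.log u)
            ≤ (1 + ε) * ((k : ℝ) * Real.log q -
                ∑ p ∈ (q ^ k - 1).primeFactors,
                  (∑ i ∈ Finset.range n, c i *
                    ((min ((q ^ k - 1).factorization p - i * u.factorization p) (u.factorization p) : ℕ) : ℝ))
                  * Real.log p) + C := by
  sorry

/-- **stub_level2_beyondLiouville (the level-2 bet on Yasufuku's `X₂'`; ⟺ a square-divisor exponent `μ < 1/2` by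
`stub_level2_iff_sqDivisorBound`, p111511).** Some TRUE weighted inequality at the family points (level 2, `F = 1`)
crosses the Liouville line: `θ₀ ≥ 0` and `4b_H + b_Y > (1+ε)(2 − c₀ − c₁)`. Its only proposed source (Nev_bir on
`X₂'`) is refuted: `Nev_bir = max{2b_H + b_Y, 2b_H/(1−c₀), (4b_H+b_Y)/(2−c₀−c₁)} = 1/τ` (lead c1, NevCertificates.md). -/
theorem stub_level2_beyondLiouville (q : ℕ) (hq : q.Prime) :
    ∃ (c : ℕ → ℝ) (bH bY ε : ℝ),
      0 ≤ bH ∧ 0 ≤ bY ∧ 0 ≤ ε ∧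
      0 ≤ 1 + ε - 2 * bH - bY ∧
      (1 + ε) * (2 - c 0 - c 1) < 4 * bH + bY ∧
      ∃ C : ℝ, ∀ k : ℕ, 1 ≤ k → ∀ u : ℕ, u ∣ q ^ k - 1 →
        MvPolynomial.eval ![((q : ℤ) ^ k), (u : ℤ)] (1 : MvPolynomial (Fin 2) ℤ) ≠ 0 →
          bH * (2 * ((k : ℝ) * Real.log q)) + bY * ((k : ℝ) * Real.log q - Real.log u)
            ≤ (1 + ε) * ((k : ℝ) * Real.log q -
                ∑ p ∈ (q ^ k - 1).primeFactors,
                  (∑ i ∈ Finset.range 2, c i *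
                    ((min ((q ^ k - 1).factorization p - i * u.factorization p) (u.factorization p) : ℕ) : ℝ))
                  * Real.log p) + C := by
  sorry

/-! ## Milestone chain (level 2): a rung of the Wieferich level ladder -/

/-- **MILESTONE ⟹ a rung of the Wieferich level ladder at every prime base**: the level-2 bet gives `μ < 1/2`
(`stub_level2_iff_sqDivisorBound`, landed), hence the crux at `q` for the fixed `ε = 2μ/(1−2μ) + 1`
(`stub_PPRAt_of_sqDivisorBound`, landed), hence infinitely many primes of level `≤ E` for any `E > ε`
(`Negative.infinite_level_le_of_PPRAt`, landed). -/
theorem ladderRung_of_level2 (q : ℕ) (hq : q.Prime) :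
    ∃ E : ℕ, {p : ℕ | p.Prime ∧ wieferichLevel q p ≤ E}.Infinite := by
  obtain ⟨μ, hμ0, hμ, h⟩ := (stub_level2_iff_sqDivisorBound hq).1 (stub_level2_beyondLiouville q hq)
  set ε : ℝ := 2 * μ / (1 - 2 * μ) + 1 with hεdef
  have h12 : 0 < 1 - 2 * μ := by linarith
  have hε0 : 0 < ε := by
    have : 0 ≤ 2 * μ / (1 - 2 * μ) := div_nonneg (by linarith) h12.le
    linarith
  have hεgt : 2 * μ / (1 - 2 * μ) < ε := by linarith
  obtain ⟨E, hE⟩ := exists_nat_gt ε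
  exact ⟨E, infinite_level_le_of_PPRAt hq hε0 E hE (stub_PPRAt_of_sqDivisorBound hq hμ0 hμ h hεgt)⟩

/-! ## Composition -/

/-- **The line closes the crux modulo its one composition stub, concluded BY NAME.** At each prime `q` and each
`θ > 0` the tower bet `stub_tower_toVojta q hq θ` supplies a level; the landed cash-out `stub_cashout` (p111458; its
on-curve hypothesis is vacuous for `F = 1`) gives `q^k − 1 ≤ C·q^{(θ₀/κ_n)k}·rad(q^k − 1)` with `θ₀/κ_n ≤ θ`; the landed
sandwich `Negative.oddWieferichExcess_mul_radical_dvd` turns this into Wieferich sparsity `E_W(q,k) < (|C|+1)·q^{θk}`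
and `Negative.PPRAt_of_wieferichSparse` into the crux at `q`. (This block is, verbatim, the `→` half of the landed
calibration `NevbirBelowBeta.stub_towerBet_iff_PPRAt`, p114863, whose `←` half `towerBet_of_PPRAt` certifies that the
stub is not stronger than the crux either; it is inlined here only so that this skeleton elaborates on a farm snapshot
that predates p114863.) -/
theorem PrimePowerRadical_of : PrimePowerRadical := by
  intro q hq
  apply PPRAt_of_wieferichSparse hq
  intro θ hθ
  obtain ⟨n, hn, c, cmin, bH, bY, ε, hc, _hbH, hbY, hε, hκ, hθ0, hmargin, hineq⟩ :=
    stub_tower_toVojta q hq θ hθ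
  -- the on-curve hypothesis of `stub_cashout` is vacuous for `F = 1`
  have hexc : ∃ C : ℝ, ∀ k : ℕ, 1 ≤ k → ∀ u : ℕ, u ^ 2 ∣ q ^ k - 1 →
      MvPolynomial.eval ![((q : ℤ) ^ k), (u : ℤ)] (1 : MvPolynomial (Fin 2) ℤ) = 0 → (u : ℝ) ≤ C :=
    ⟨0, fun k _ u _ h0 => by simp at h0⟩
  obtain ⟨C, hC⟩ := stub_cashout hq.two_le hn hc hbY hε hκ hθ0 hineq hexc
  have hq0 : (0 : ℝ) < q := by exact_mod_cast hq.pos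
  have hq1 : (1 : ℝ) ≤ q := by exact_mod_cast hq.one_lt.le
  have hρθ : (1 + ε - 2 * bH - bY) / ((1 + ε) * cmin - bY * (((n : ℝ) + 1) / (2 * n))) ≤ θ := by
    rw [div_le_iff₀ hκ]; exact hmargin
  refine ⟨|C| + 1, by positivity, fun k hk => ?_⟩
  have hm0 : 0 < q ^ k - 1 := by have := two_le_pow hq.two_le hk; omega
  have hle : oddWieferichExcess q k * radical (q ^ k - 1) ≤ q ^ k - 1 :=
    Nat.le_of_dvd hm0 (oddWieferichExcess_mul_radical_dvd hq.two_le hk)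
  have hleR : (oddWieferichExcess q k : ℝ) * ((radical (q ^ k - 1) : ℕ) : ℝ) ≤ ((q ^ k - 1 : ℕ) : ℝ) := by
    exact_mod_cast hle
  have hR0 : (0 : ℝ) < ((radical (q ^ k - 1) : ℕ) : ℝ) := by exact_mod_cast Nat.radical_pos _
  have h1 := hleR.trans (hC k hk)
  have h2 : (oddWieferichExcess q k : ℝ) ≤
      C * (q : ℝ) ^ ((1 + ε - 2 * bH - bY) / ((1 + ε) * cmin - bY * (((n : ℝ) + 1) / (2 * n))) * k) :=
    le_of_mul_le_mul_right h1 hR0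
  have h3 : (q : ℝ) ^ ((1 + ε - 2 * bH - bY) / ((1 + ε) * cmin - bY * (((n : ℝ) + 1) / (2 * n))) * k)
      ≤ (q : ℝ) ^ (θ * k) := by
    apply Real.rpow_le_rpow_of_exponent_le hq1
    exact mul_le_mul_of_nonneg_right hρθ (Nat.cast_nonneg k)
  have h4 : (0 : ℝ) < (q : ℝ) ^ (θ * k) := Real.rpow_pos_of_pos hq0 _
  have h5 : (0 : ℝ) ≤
      (q : ℝ) ^ ((1 + ε - 2 * bH - bY) / ((1 + ε) * cmin - bY * (((n : ℝ) + 1) / (2 * n))) * k) :=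
    Real.rpow_nonneg hq0.le _
  calc (oddWieferichExcess q k : ℝ)
      ≤ C * (q : ℝ) ^ ((1 + ε - 2 * bH - bY) / ((1 + ε) * cmin - bY * (((n : ℝ) + 1) / (2 * n))) * k) := h2
    _ ≤ |C| * (q : ℝ) ^ ((1 + ε - 2 * bH - bY) / ((1 + ε) * cmin - bY * (((n : ℝ) + 1) / (2 * n))) * k) :=
        mul_le_mul_of_nonneg_right (le_abs_self C) h5
    _ ≤ |C| * (q : ℝ) ^ (θ * k) := mul_le_mul_of_nonneg_left h3 (abs_nonneg C)
    _ < (|C| + 1) * (q : ℝ) ^ (θ * k) := by nlinarith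

end Summit.ABC.ABC.Cruxes.PrimePowerRadical.NevbirBelowBeta

end
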